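/-
Origin: expansion seat `planner-pub-hodgecm-pv15-g4-0`, handover #1 2026-08-18T10:07:21Z (`HOME/pub-hodgecm-pv15-g4/lean/Pv15g4/KernelModelSchrodinger.lean`, md5 45b02bcc, 373 lines);
landed by the gen-7 packager in gate run 28 as `HodgeCM/Automorphic/KernelModelSchrodinger.lean` (verbatim).
-/
/-
Origin: HOME/pub-hodgecm-pv15-g4/lean/Pv15g4/KernelModelSchrodinger.lean — session planner-pub-hodgecm-pv15-g4-0
(unit pub-hodgecm-pv15-g4, DAG-NODE PROVER #15 gen 4; lineage N23a → N23c, PerL v5 Prop 3.6 Step 2, ll. 386–432).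
Intended final place (packager's call): `HodgeCM/Automorphic/KernelModelSchrodinger.lean`.
NEW, ADDITIVE LEAF; imports ONLY tree modules: `HodgeCM.Automorphic.LatticeModelThetaData` (prl1-g4, run 25/26),
`HodgeCM.Automorphic.KernelCompactTorusModel` (pv15-g2, run 26) and `HodgeCM.PerL34.ArchAWeilSchrodingerWitness`
(pv02-g5 #4, run 27; hence pv14-g4's `HodgeCM.Automorphic.WeilThetaModelSchrodinger`, run 27).
KIND: KERNEL — complete proofs, no new axioms, nothing cited, nothing posited, NO `Prop`-valued hypothesis anywhere.
-/
import Summits.HodgeConjecture.HodgeCM.Automorphic.LatticeModelThetaData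
import Summits.HodgeConjecture.HodgeCM.Automorphic.KernelCompactTorusModel
import Summits.HodgeConjecture.HodgeCM.PerL34.ArchAWeilSchrodingerWitness

/-!
# The theta-KERNEL MODEL of N23a/N23c instantiated on a CONSTRUCTED Weil theta model

pv15-g2's kernel model of PerL v5 Prop. 3.6 (`KernelModel.core`, `KernelTorusCarrier`, `KernelTorusCarrier.CompactInput`,
files `KernelCarrier` … `KernelCompactTorusModel`, runs 24–26) proves the analytic inputs of Step 2 — AX5b, AX12 (i)(ii),
the unfolding identity (U), `fourier`, and finally AX8 = `AnalyticK` (`analyticK_of_compactInput`) — for ANY theta kernel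
`(ω, Θ)` satisfying three structural laws, over ANY cocompact Haar model of `[U(W)]` and ANY compact-quotient torus input.
So far the only inhabitant fed to it is prl1-g4's adelic unitary model, whose theta kernel is itself a residual
(GAPS carverg2-X1).  This file feeds it an HONESTLY CONSTRUCTED kernel: pv14-g4's Schrödinger–lattice Weil theta model
`SchwartzWeil.schrodingerModel E L m Γ hΓ : WeilThetaModel (Multiplicative E) (latticeSubgroup E L) Circle Γ`
([We64] n° 41: `E` a finite-dimensional real normed space, `L` a full discrete `ℤ`-lattice, `U(W) ↦ U(1)` acting on
`𝓢(E, ℂ)` by the weight-`m` character, `Γ ⊆ μ_m` finite, `Θ_Φ(S) = Σ_{v ∈ L} (SΦ)(v)`), through prl1-g4's lattice-model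
bridge (`CocompactLatticeModel`, `QuotientModel.ofLattice`), and checks that EVERYTHING downstream closes with no
hypothesis left:

* §1 the two cocompact lattice models `(E, L)` and `(U(1), Γ)` (`latticeModel`, `circleModel`; compactness of `E ⧸ L` is
  pv02-g5's `ArchAWeil.compactSpace_quotient_lattice`) and their quotient models `QU`, `QW` (Haar measure, unimodularity,
  fundamental domain, folded measure `ν = π_*(μ|𝓕)`, `L²`, regular representation — all CONSTRUCTED by `ofLattice`);
* §2 the kernel core carrier `core := KernelModel.core QU QW 𝓢 ω Θ` of the model, its three STRUCTURAL LAWS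
  (`structural` = prl1-g4 `WeilThetaModel.structural_laws`) and AX1b(a) (`hatτ_complete` = prl1-g3 `core_hatτ_complete`);
* §3 the torus side with `T(𝔸) := U(1) = U(W)(𝔸)` ITSELF (rank one: the maximal compact torus is the whole group),
  `jT := id`, `β :=` the constant `T(L₀)`-partition of unity `1/|Γ|`, ONE character `χ = w = (u ↦ u^{-m})`
  (pv02-g5's `zpowNegHom`), Haar probability `ν` (`torusCarrier`): AX5b (`AX5b`), AX12(i) (`AX12_transl_cont`) and the
  unfolding identity (U) = AX12(ii) (`AX12_unfold`) hold BY NAME in the cocompact Haar model `QW.isCocompactHaarModel`, and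
  the toric period is COMPUTED (`ϑc_eq`, `ϑc_mk`): `ϑ_{T,χ}(Φ)(aL) = (1/|Γ|) · Θ_Φ(aL, 1) = (1/|Γ|) · Σ_{v ∈ L} Φ(a + v)`
  — non-zero for pv14-g4's bump (`ϑc_ne_zero`), so none of the statements below is about the zero functional;
* §4 the compact-quotient input `compactInput : torusCarrier.CompactInput` CONSTRUCTED field by field (`Λ := Γ`,
  `exists_fd` = pv09-g4 `DiscreteFD.exists_isFundamentalDomain_op_finite`, `β_sum`, `Tc := U(1)` with its Haar
  probability, `w`, `Ew_eq := rfl`, `emb := ArchAWeil.powChar` (pv02-g5), `emb_spec`, `emb_surj`, `Gf` trivial, `dense`),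
  hence **`analyticK : torusCarrier.AnalyticK`** (AX8 = Prop. 3.6 Step 2 for this torus side, pv15-g2
  `analyticK_of_compactInput`) and **`analyticU : torusCarrier.toRegTorusCarrier.AnalyticU QW.μ`** (run 24's analytic
  package incl. (U), `AnalyticK.toAnalyticU`) — BOTH WITH NO HYPOTHESIS.

HONEST SCOPE.  This is the rank-one archimedean shadow of PerL's situation (pv14-g4's dictionary `X_k ↦ L`,
`S(X_𝔸) ↦ 𝓢(E, ℂ)`, `Mp ↦ E × U(1)`), NOT PerL's adelic `𝒮^κ` / `U(2,1)` theta kernel (DIVERGENCE.md stands; the genuine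
adelic MODEL is GAPS carverg2-X1, owned by prl1/pv09/pv06).  Its content is a non-vacuity and consistency certificate:
the binder types of the whole kernel-model torus package (pv15-g2 runs 24–26, pv06-g3/g4 `CompactTorusModel`,
prl1-g4 `LatticeModelThetaData`/`AdelicTorusCompactInput`) are SIMULTANEOUSLY inhabited by a constructed model with
non-zero toric periods, and the package composes end-to-end in the kernel.

PUBLISHED inputs cited as hypotheses: none.  No placeholders; axioms ⊆ {propext, Classical.choice, Quot.sound}.
Borel structure on `U(1)`: Mathlib fixes none; this file uses the Borel σ-algebra (`borelCircle`, a reducible local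
instance — the convention of `ModelCarrier` §ModelSanity and `S5ConservativeQaut.measCircle`).
-/

set_option autoImplicit false

noncomputable section

open MeasureTheory Topology
open HodgeCM.PerL34 HodgeCM.PerL34.ArchAWeil

attribute [-instance] Quotient.instMeasurableSpace

namespace HodgeCM
namespace SchwartzWeil
namespace SchrodingerKernel

/-- The Borel σ-algebra on `U(1)` (Mathlib registers none). -/
@[reducible] def borelCircle : MeasurableSpace Circle := borel Circle

attribute [local instance] borelCircle

/-- (Ported verbatim from the HodgeCMPerL package; no docstring in the source.) -/
local instance borelSpace_circle : BorelSpace Circle := ⟨rfl⟩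

/-! ## 1. The two cocompact lattice models and their quotient models -/

section Models

variable (E : Type) [NormedAddCommGroup E] [NormedSpace ℝ E] [FiniteDimensional ℝ E]
  (L : Submodule ℤ E) [DiscreteTopology L] [IsZLattice ℝ L] (Γ : Subgroup Circle) [Finite Γ]

omit [NormedSpace ℝ E] [FiniteDimensional ℝ E] [IsZLattice ℝ L] in
/-- The multiplicative copy `latticeSubgroup E L ≤ Multiplicative E` of a discrete lattice is discrete. -/
instance discreteTopology_latticeSubgroup : DiscreteTopology (latticeSubgroup E L) :=
  DiscreteTopology.of_continuous_injective
    (f := fun x : latticeSubgroup E L => (⟨Multiplicative.toAdd x.1, (mem_latticeSubgroup E L x.1).1 x.2⟩ : L))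
    (Continuous.subtype_mk (continuous_toAdd.comp continuous_subtype_val) _)
    (fun _ _ h => Subtype.ext (Multiplicative.toAdd.injective (congrArg Subtype.val h)))

/-- **The `G_U`-side lattice model `(E, L)`**: `G_U(𝔸) ↦ E` (as `Multiplicative E`), `G_U(L₀) ↦ L`; `[G_U] = E ⧸ L` is
compact (pv02-g5 `ArchAWeil.compactSpace_quotient_lattice`). -/
def latticeModel : CocompactLatticeModel where
  G := Multiplicative E
  Γ := latticeSubgroup E L

/-- **The `U(W)`-side lattice model `(U(1), Γ)`**: `U(W)(𝔸) ↦ U(1)`, `U(W)(L⁺) ↦ Γ` finite. -/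
def circleModel : CocompactLatticeModel where
  G := Circle
  Γ := Γ

/-- The quotient model of `[G_U] = E ⧸ L` (prl1-g4 `QuotientModel.ofLattice`: Haar measure, fundamental domain, …). -/
abbrev QU : QuotientModel := (latticeModel E L).toQuotientModel

/-- The quotient model of `[U(W)] = U(1) ⧸ Γ`. -/
abbrev QW : QuotientModel := (circleModel Γ).toQuotientModel

/-- (Ported verbatim from the HodgeCMPerL package; no docstring in the source.) -/
theorem QU_G : (QU E L).G = Multiplicative E := rfl
/-- (Ported verbatim from the HodgeCMPerL package; no docstring in the source.) -/
theorem QU_Γ : (QU E L).Γ = latticeSubgroup E L := rfl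
/-- (Ported verbatim from the HodgeCMPerL package; no docstring in the source.) -/
theorem QW_G : (QW Γ).G = Circle := rfl
/-- (Ported verbatim from the HodgeCMPerL package; no docstring in the source.) -/
theorem QW_Γ : (QW Γ).Γ = Γ := rfl

/-- `[U(W)]` is a cocompact Haar model (pv15-g2/prl1-g3, a theorem of every quotient model). -/
theorem isCocompactHaarModel_QW : RegularRep.IsCocompactHaarModel (QW Γ).Γ (QW Γ).ν (QW Γ).μ :=
  (QW Γ).isCocompactHaarModel

end Models

/-! ## 2. The kernel core carrier of the Schrödinger–lattice model and its structural laws -/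

section Core

variable (E : Type) [NormedAddCommGroup E] [NormedSpace ℝ E] [FiniteDimensional ℝ E]
  (L : Submodule ℤ E) [DiscreteTopology L] [IsZLattice ℝ L] (m : ℤ) (Γ : Subgroup Circle) [Finite Γ]
  (hΓ : ∀ u ∈ Γ, u ^ m = 1)

/-- pv14-g4's Schrödinger–lattice Weil theta model, read over the quotient models `QU`, `QW` (same term). -/
abbrev W : WeilThetaModel (QU E L).G (QU E L).Γ (QW Γ).G (QW Γ).Γ := schrodingerModel E L m Γ hΓ

/-- **The kernel core carrier** of the model: `ω`, `Θ`, `inclCG = periodCLM`, `τ̂ =` the isotypic components of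
`L²(E ⧸ L)` (pv15-g2 `KernelModel.core`). -/
abbrev core :=
  KernelModel.core (QU E L) (QW Γ) (W E L m Γ hΓ).SK (W E L m Γ hΓ).omg (W E L m Γ hΓ).θ

/-- **The three structural laws hold** (prl1-g4 `WeilThetaModel.structural_laws`): `ω(1) = id`, `Θ` continuous,
`Θ_{ω(h)Φ}(ξ, q) = Θ_Φ(ξ, h⁻¹ q)`. -/
theorem structural :
    (∀ Φ, (core E L m Γ hΓ).omg 1 Φ = Φ) ∧ Continuous (core E L m Γ hΓ).θ ∧
      ∀ (h : (QW Γ).G) Φ ξ (q : (QW Γ).G ⧸ (QW Γ).Γ),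
        (core E L m Γ hΓ).θ ((core E L m Γ hΓ).omg h Φ) (ξ, q) = (core E L m Γ hΓ).θ Φ (ξ, h⁻¹ • q) :=
  (W E L m Γ hΓ).structural_laws

/-- **AX1b(a) for the model**: the isotypic components `τ̂` of `L²(E ⧸ L)` have dense span (prl1-g3/pv15-g2
`KernelModel.core_hatτ_complete`, from pv06-g3's compact approximation of the regular representation). -/
theorem hatτ_complete : (⨆ j, (core E L m Γ hΓ).hatτ j).topologicalClosure = ⊤ :=
  KernelModel.core_hatτ_complete (QU E L) (QW Γ) _ _ _

/-- `Θ_{ω(h)Φ}` is the `h`-translate of the family `Θ_Φ` (pv15-g2 `KernelCoreCarrier.θ_omg_eq`). -/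
theorem θ_omg_eq (h : (QW Γ).G) (Φ : (W E L m Γ hΓ).SK) :
    (core E L m Γ hΓ).θ ((core E L m Γ hΓ).omg h Φ) = KernelOp.translFamily ((core E L m Γ hΓ).θ Φ) h :=
  (core E L m Γ hΓ).θ_omg_eq (W E L m Γ hΓ).θ_omg h Φ

end Core

/-! ## 3. The torus side: `T = U(1)` itself, one character `χ = w = u ↦ u^{-m}` -/

section Weight

variable (m : ℤ)

/-- The weight `w = χ : u ↦ u^{-m}` as a `ℂ`-valued character of `U(1)` (pv02-g5's `zpowNegHom` composed with the
inclusion `U(1) ⊂ ℂ`). -/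
def weightHom : Circle →* ℂ := Circle.coeHom.comp (zpowNegHom m)

/-- (Ported verbatim from the HodgeCMPerL package; no docstring in the source.) -/
@[simp] theorem weightHom_apply (u : Circle) : weightHom m u = ((u ^ (-m) : Circle) : ℂ) := rfl

/-- (Ported verbatim from the HodgeCMPerL package; no docstring in the source.) -/
theorem continuous_weightHom : Continuous (weightHom m) :=
  continuous_subtype_val.comp (continuous_zpow (-m))

/-- (Ported verbatim from the HodgeCMPerL package; no docstring in the source.) -/
theorem norm_weightHom (u : Circle) : ‖weightHom m u‖ = 1 := Circle.norm_coe _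

end Weight

/-- The Haar probability measure of `U(1)`. -/
def haarCircle : Measure Circle := Measure.haarMeasure ⊤

/-- (Ported verbatim from the HodgeCMPerL package; no docstring in the source.) -/
instance isHaarMeasure_haarCircle : (haarCircle).IsHaarMeasure := by
  unfold haarCircle; infer_instance

/-- (Ported verbatim from the HodgeCMPerL package; no docstring in the source.) -/
instance isProbabilityMeasure_haarCircle : IsProbabilityMeasure haarCircle := by
  refine ⟨?_⟩
  have h := Measure.haarMeasure_self (G := Circle) (K₀ := ⊤)
  rwa [TopologicalSpace.PositiveCompacts.coe_top] at h

section Torus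

variable (E : Type) [NormedAddCommGroup E] [NormedSpace ℝ E] [FiniteDimensional ℝ E]
  (L : Submodule ℤ E) [DiscreteTopology L] [IsZLattice ℝ L] (m : ℤ) (Γ : Subgroup Circle) [Finite Γ]
  (hΓ : ∀ u ∈ Γ, u ^ m = 1)

/-- **The torus-side carrier of the model**: `T(𝔸) := U(1)`, `jT := id`, compact torus `T(L₀ ⊗ ℝ) := U(1)` with weight
`w = u^{-m}`, Haar probability `ν`, the constant partition of unity `β = 1/|Γ|`, and the single character `χ = w`
(index type `Unit`, allowed). -/
def torusCarrier : KernelTorusCarrier (core E L m Γ hΓ) Circle where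
  X := Unit
  allowed := fun _ => True
  Tι := Circle
  torus := ⇑((ContinuousMonoidHom.id Circle).toMonoidHom.comp (MonoidHom.id Circle))
  w := ⇑(weightHom m)
  ν := haarCircle
  jT := ContinuousMonoidHom.id Circle
  β := ⟨ContinuousMap.const Circle (1 / (Nat.card Γ : ℝ)), (isClosed_tsupport _).isCompact⟩
  χv := fun _ => ⟨fun u => ((u ^ (-m) : Circle) : ℂ), continuous_subtype_val.comp (continuous_zpow (-m))⟩

/-- (Ported verbatim from the HodgeCMPerL package; no docstring in the source.) -/
theorem torusCarrier_ν : (torusCarrier E L m Γ hΓ).ν = haarCircle := rfl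

/-- (Ported verbatim from the HodgeCMPerL package; no docstring in the source.) -/
instance isHaarMeasure_ν : (torusCarrier E L m Γ hΓ).ν.IsHaarMeasure := isHaarMeasure_haarCircle
/-- (Ported verbatim from the HodgeCMPerL package; no docstring in the source.) -/
instance isProbabilityMeasure_ν : IsProbabilityMeasure (torusCarrier E L m Γ hΓ).ν := isProbabilityMeasure_haarCircle
/-- (Ported verbatim from the HodgeCMPerL package; no docstring in the source.) -/
instance isFiniteMeasureOnCompacts_ν : IsFiniteMeasureOnCompacts (torusCarrier E L m Γ hΓ).ν := inferInstance
/-- (Ported verbatim from the HodgeCMPerL package; no docstring in the source.) -/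
instance isOpenPosMeasure_ν : (torusCarrier E L m Γ hΓ).ν.IsOpenPosMeasure := inferInstance
/-- (Ported verbatim from the HodgeCMPerL package; no docstring in the source.) -/
instance isMulRightInvariant_ν : (torusCarrier E L m Γ hΓ).ν.IsMulRightInvariant := inferInstance

/-- (Ported verbatim from the HodgeCMPerL package; no docstring in the source.) -/
theorem pt_eq (t : Circle) : (torusCarrier E L m Γ hΓ).pt t = QuotientGroup.mk t⁻¹ := rfl

/-- (Ported verbatim from the HodgeCMPerL package; no docstring in the source.) -/
@[simp] theorem β_apply (t : Circle) : (torusCarrier E L m Γ hΓ).β t = 1 / (Nat.card Γ : ℝ) := rfl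

/-- (Ported verbatim from the HodgeCMPerL package; no docstring in the source.) -/
@[simp] theorem χv_apply (x : Unit) (t : Circle) :
    (torusCarrier E L m Γ hΓ).χv x t = ((t ^ (-m) : Circle) : ℂ) := rfl

/-- **AX5b holds**: the toric period `ϑ_{T,χ}` is continuous on `𝓢` (pv15-g2 `KernelTorusCarrier.AX5b_holds`). -/
theorem AX5b (x : Unit) : Continuous ((torusCarrier E L m Γ hΓ).ϑc x) :=
  (torusCarrier E L m Γ hΓ).AX5b_holds (W E L m Γ hΓ).θ_cont x

/-- **AX12(i) holds**: `h ↦ ϑ_{T,χ}(ω(h)Φ)` is continuous (pv15-g2 `AX12_transl_cont_holds`). -/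
theorem AX12_transl_cont (x : Unit) (Φ : (W E L m Γ hΓ).SK) :
    Continuous fun h => (torusCarrier E L m Γ hΓ).ϑc x ((core E L m Γ hΓ).omg h Φ) :=
  (torusCarrier E L m Γ hΓ).AX12_transl_cont_holds (W E L m Γ hΓ).θ_omg x Φ

/-- **The unfolding identity (U) = AX12(ii) holds** in the cocompact Haar model of `[U(W)] = U(1) ⧸ Γ`
(pv15-g2 `KernelTorusCarrier.AX12_unfold_holds`): `T_Φ(E_χ f) = ∫_{U(1)} f(h) ϑ_{T,χ}(ω(h)Φ) dh`. -/
theorem AX12_unfold (Φ : (W E L m Γ hΓ).SK) (x : Unit) (f : CompactlySupportedContinuousMap Circle ℂ) :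
    (core E L m Γ hΓ).toRegCoreCarrier.toRepCoreCarrier.toCoreCarrier.TΦ Φ
        ((torusCarrier E L m Γ hΓ).toRegTorusCarrier.E x f) =
      ∫ h, f h • (core E L m Γ hΓ).toRegCoreCarrier.inclCG
        ((torusCarrier E L m Γ hΓ).toRegTorusCarrier.ϑc x ((core E L m Γ hΓ).toRegCoreCarrier.omg h Φ)) ∂(QW Γ).μ :=
  (torusCarrier E L m Γ hΓ).AX12_unfold_holds (QW Γ).isCocompactHaarModel (W E L m Γ hΓ).θ_omg Φ x f
    ((torusCarrier E L m Γ hΓ).AX12_transl_cont_holds (W E L m Γ hΓ).θ_omg x Φ)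

/-- **The toric period is computed**: `ϑ_{T,χ}(Φ)(ξ) = (1/|Γ|) · Θ_Φ(ξ, 1)` — the integrand
`β(t) χ(t) Θ_Φ(ξ, t⁻¹) = (1/|Γ|) t^{-m} t^{m} Θ_Φ(ξ, 1)` is constant (every kernel has weight `m`, pv02-g5 `θ_apply_inv`)
and `ν` is a probability measure. -/
theorem ϑc_eq (x : Unit) (Φ : (W E L m Γ hΓ).SK) (ξ : Multiplicative E ⧸ latticeSubgroup E L) :
    (torusCarrier E L m Γ hΓ).ϑc x Φ ξ = (1 / (Nat.card Γ : ℂ)) * (schrodingerModel E L m Γ hΓ).θ Φ (ξ, 1) := by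
  rw [KernelTorusCarrier.ϑc_apply]
  have hconst : (fun t : Circle => N23a.wt (⇑(torusCarrier E L m Γ hΓ).β) (⇑((torusCarrier E L m Γ hΓ).χv x)) t *
      (core E L m Γ hΓ).θ Φ (ξ, (torusCarrier E L m Γ hΓ).pt t)) =
      fun _ => (1 / (Nat.card Γ : ℂ)) * (schrodingerModel E L m Γ hΓ).θ Φ (ξ, 1) := by
    funext t
    change (((1 / (Nat.card Γ : ℝ) : ℝ) : ℂ) * (((t ^ (-m) : Circle) : ℂ))) *
        (schrodingerModel E L m Γ hΓ).θ Φ (ξ, (QuotientGroup.mk t⁻¹ : Circle ⧸ Γ)) = _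
    rw [θ_apply_inv, Circle.coe_zpow, zpow_neg, mul_assoc,
      inv_mul_cancel_left₀ (zpow_ne_zero m (Circle.coe_ne_zero t))]
    push_cast
    ring
  rw [hconst, integral_const, probReal_univ, one_smul]

/-- … and on cosets `aL`: `ϑ_{T,χ}(Φ)(aL) = (1/|Γ|) · Σ_{v ∈ L} Φ(a + v)` (pv14-g4 `schrodingerModel_θ_mk`). -/
theorem ϑc_mk (x : Unit) (Φ : SchwartzMap E ℂ) (a : Multiplicative E) :
    (torusCarrier E L m Γ hΓ).ϑc x ⟨Φ, Set.mem_univ Φ⟩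
        (QuotientGroup.mk a : Multiplicative E ⧸ latticeSubgroup E L) =
      (1 / (Nat.card Γ : ℂ)) * ∑' v : L, Φ (Multiplicative.toAdd a + (v : E)) := by
  have h := schrodingerModel_θ_mk E L m Γ hΓ Φ a 1
  rw [QuotientGroup.mk_one, Circle.coe_one, one_zpow, inv_one, one_mul] at h
  rw [ϑc_eq, h]

/-- **The toric period functional is not zero**: some `ϑ_{T,χ}(Φ)(0) ≠ 0` (pv14-g4's Schwartz bump,
`schrodingerModel_θ_ne_zero`). -/
theorem ϑc_ne_zero (x : Unit) :
    ∃ Φ : (W E L m Γ hΓ).SK,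
      (torusCarrier E L m Γ hΓ).ϑc x Φ (QuotientGroup.mk 1 : Multiplicative E ⧸ latticeSubgroup E L) ≠ 0 := by
  obtain ⟨Φ, hΦ⟩ := schrodingerModel_θ_ne_zero E L m Γ hΓ
  refine ⟨Φ, fun h => hΦ ?_⟩
  rw [ϑc_eq, mul_eq_zero] at h
  rcases h with h | h
  · exact absurd h (one_div_ne_zero (Nat.cast_ne_zero.mpr (Nat.card_pos (α := Γ)).ne'))
  · exact h

end Torus

/-! ## 4. The compact-quotient input, constructed; AX8 (`AnalyticK`) and `AnalyticU` with no hypothesis -/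

section Compact

variable (E : Type) [NormedAddCommGroup E] [NormedSpace ℝ E] [FiniteDimensional ℝ E]
  (L : Submodule ℤ E) [DiscreteTopology L] [IsZLattice ℝ L] (m : ℤ) (Γ : Subgroup Circle) [Finite Γ]
  (hΓ : ∀ u ∈ Γ, u ^ m = 1)

/-- The constant `1/|Γ|` summed over `Γ` is `1`. -/
theorem tsum_const_card_inv :
    ∑' _ : Γ.op, (((1 / (Nat.card Γ : ℝ) : ℝ)) : ℂ) = 1 := by
  rw [tsum_const, Nat.card_congr (Subgroup.equivOp Γ).symm, nsmul_eq_mul]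
  have h : (Nat.card Γ : ℂ) ≠ 0 := Nat.cast_ne_zero.mpr (Nat.card_pos (α := Γ)).ne'
  push_cast
  field_simp

/-- **The compact-quotient input of the model, CONSTRUCTED**: `T(L₀) := Γ` (finite), a fundamental domain (pv09-g4),
`β = 1/|Γ|` sums to one over `Γ`, `T(L₀ ⊗ ℝ) := U(1)` with its Haar probability and weight `w = u^{-m}`,
`E_w = ⋂_t ker(R(t) - w(t))` by `rfl`, the allowed characters `= {u^{-m}}` embedded as pv02-g5's `powChar`
(`emb_spec`, `emb_surj`: a character of `U(1) ⧸ Γ` whose pull-back to `U(1)` is `w` IS `powChar`), trivial finite part,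
and `U(W)(L₀)·T(𝔸)·U(W)(𝔸_f) = U(1)` trivially dense. -/
def compactInput : (torusCarrier E L m Γ hΓ).CompactInput where
  Λ := Γ
  instΛ₂ := Subgroup.isClosed_of_discrete
  exists_fd := by
    obtain ⟨𝓕, -, h𝓕, -, hfin⟩ :=
      DiscreteFD.exists_isFundamentalDomain_op_finite Γ (torusCarrier E L m Γ hΓ).ν
    exact ⟨𝓕, h𝓕, hfin⟩
  jT_Λ := fun u hu => hu
  β_sum := fun t => by
    change ∑' _ : Γ.op, (((1 / (Nat.card Γ : ℝ) : ℝ)) : ℂ) = 1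
    exact tsum_const_card_inv Γ
  Tc := Circle
  μ := haarCircle
  ιc := MonoidHom.id Circle
  ιc_cont := continuous_id
  w := weightHom m
  w_cont := continuous_weightHom m
  w_norm := norm_weightHom m
  Ew_eq := rfl
  emb := fun _ => powChar m Γ hΓ
  emb_spec := fun _ t => by
    rw [Annihilation.dualChar_apply]
    change ((powChar m Γ hΓ (QuotientGroup.mk t) : Circle) : ℂ) = ((t ^ (-m) : Circle) : ℂ)
    rw [powChar_mk]
  emb_surj := fun ξ hξ => by
    refine ⟨(), ContinuousMonoidHom.ext fun q => ?_⟩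
    induction q using QuotientGroup.induction_on with
    | H u =>
      have hu := DFunLike.congr_fun hξ u
      simp only [MonoidHom.coe_comp, Function.comp_apply, MonoidHom.id_apply, QuotientGroup.mk'_apply,
        Annihilation.dualChar_apply, weightHom_apply] at hu
      rw [powChar_mk]
      exact (Circle.ext_iff.mpr hu).symm
  Gf := Unit
  ιf := 1
  comm := fun hf t => by rw [MonoidHom.one_apply, one_mul, mul_one]
  dense := fun g => subset_closure ⟨1, one_mem _, g, (), by
    rw [MonoidHom.one_apply, one_mul, mul_one]; rfl⟩

/-- **AX8 (PerL v5 Prop. 3.6 Step 2) for the model's torus side, with NO hypothesis**: from the cocompact Haar model of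
`[U(W)]`, AX1b(a) and the constructed compact-quotient input (pv15-g2 `KernelTorusCarrier.analyticK_of_compactInput`). -/
theorem analyticK : (torusCarrier E L m Γ hΓ).AnalyticK :=
  (torusCarrier E L m Γ hΓ).analyticK_of_compactInput (QW Γ).isCocompactHaarModel (hatτ_complete E L m Γ hΓ)
    (compactInput E L m Γ hΓ)

/-- **Run 24's analytic package `AnalyticU`** (AX5b, AX12, (U), hence AX8 at the regular-representation level) for the
model's torus side in the Haar model `μ` of `U(W)(𝔸) = U(1)`, with NO hypothesis (pv15-g2 `AnalyticK.toAnalyticU`). -/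
theorem analyticU : (torusCarrier E L m Γ hΓ).toRegTorusCarrier.AnalyticU (QW Γ).μ :=
  KernelTorusCarrier.AnalyticK.toAnalyticU (QW Γ).isCocompactHaarModel (W E L m Γ hΓ).θ_cont (W E L m Γ hΓ).θ_omg
    (analyticK E L m Γ hΓ)

/-- The same input read as pv06-g3's `CompactTorusModelData` (with `unfold` PROVED) and as pv15-g2's
`QuotientTorusDatum` of the model — by name, for consumers of those interfaces. -/
def modelData :=
  (compactInput E L m Γ hΓ).toModelData (QW Γ).isCocompactHaarModel

/-! ### Smoke: every instance hypothesis is met by Mathlib objects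

`E = ℝⁿ` (sup norm), `L = ℤⁿ` (the `ℤ`-span of the standard basis: discrete and a full lattice by Mathlib's `ZSpan`
instances), `Γ = {1}`, any weight `m`. -/
example (n : ℕ) (m : ℤ) :
    (torusCarrier (Fin n → ℝ) (Submodule.span ℤ (Set.range (Pi.basisFun ℝ (Fin n)))) m ⊥
      (fun u hu => by rw [Subgroup.mem_bot] at hu; rw [hu, one_zpow])).AnalyticK :=
  analyticK _ _ m ⊥ _

end Compact

end SchrodingerKernel
end SchwartzWeil
end HodgeCM
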